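import Summits.QuantumAdvantage.QuantumAdvantage.Theorems.PhaseDialA

/-! # PhaseDialB — part 2/6 of the landing twins of NODE «PhaseDial» (decomp-qadv lens-2 g25; node file
`g25/PhaseDial.lean`, sha256 bb3dee64cd7f1b2c…; generator `g25/tree/gen_twins.py`: namespace `Theses.PhaseDial` →
`Theorems.PhaseDial`, cut at section boundaries (node lines 307–600), nothing else).
Content: §3 the g23 matching family `qStrat` IS phase form `(2, 1, 2)` (`q_phaseForm`, `q_stabPhase`, `q_special_certificate`) and §4a the COUNTING CERTIFICATE, first half (multiplexer layout with shadow address cells, `yin` test inputs, `decode`, the coefficient/table data `cof` and `cof_injective`). -/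

set_option linter.dupNamespace false
noncomputable section
open scoped Classical

namespace Summit.QuantumAdvantage.QuantumAdvantage.Theorems.PhaseDial
open Finset
open Literature.Computability.QuantumComplexity Literature.Computability.QuantumComplexity.RingHLF
open Literature.Computability.MetaComplexity Literature.Computability.MetaComplexity.Smolensky
open Summit.QuantumAdvantage.AdviceFreeQNC0
open Summit.QuantumAdvantage.QuantumAdvantage.Theorems.AnchorDial (outB dev loss_shape_mono)
open Summit.QuantumAdvantage.QuantumAdvantage.Theorems.StabilizerDial (apIdx apStrat apStrat_mem apStrat_apply pad
  pad_mem StabFew outB_pad_pad outB_pad_congr bitP_gsum gsum gsum_mem deg_gsum dev_congr eventually_polylog winset_pad)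
open Summit.QuantumAdvantage.QuantumAdvantage.Theorems.SparsityDial (real_loss_of_frac stabFew_mono_mr one_le_logpow)
open Summit.QuantumAdvantage.QuantumAdvantage.Theorems.ResponseDial (mem_dev_apStrat dev_pad_zero
  not_polylogSparse_of_agree)
open Summit.QuantumAdvantage.QuantumAdvantage.Theorems.CounterDial (CounterForm StabCounter)
open Summit.QuantumAdvantage.QuantumAdvantage.Theorems.AbelianDial (alin TableForm StabTable AbelianLoss3
  NonAbelianLoss3 tableForm_of_counterForm stabTable_of_stabCounter nT pcell qcell pcell_injective qcell_injective
  pcell_ne_qcell qG qG_apply qStrat qStrat_agree qStrat_mem6 mem_dev_q_second indB oddZeros_indB)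
open Summit.QuantumAdvantage.QuantumAdvantage.Theorems.AbelianDial (q_in_dense_class q_not_tableForm_zero
  q_not_counterForm_zero)
open Summit.QuantumAdvantage.QuantumAdvantage.Theorems.ShadowDial (aL aW aW_pos two_mul_le_two_pow aW_mul_eight aL_lt
  aL_add_three_le acell enc dcell acell_val dcell_val acell_injective dcell_injective acell_ne_dcell dcell_ne_zero
  dcell_lt_last muxStrat muxStrat_agree muxStrat_mem_logpow mem_dev_mux_second shadow shadow_pad_zero
  q_shadow_degree_linear)
open Summit.QuantumAdvantage.QuantumAdvantage.Theorems.ScaleDial (logpow_add_logpow_le)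

variable {N : ℕ}

/-! ## §3  The matching family `qStrat` (NODE «AbelianDial»'s generic inhabitant) IS phase form `(2, 1, 2)` -/

/-- the `2`-tuple `(pcell t, qcell k t)` of the matched pair `t` at position `k`. -/
def pairT (k : Fin N) (t : Fin (nT N)) : Fin 2 → Fin N := fun s => if s.val = 0 then pcell t else qcell k t

/-- distinct pairs give distinct tuples. -/
theorem pairT_injective (k : Fin N) : Function.Injective (pairT k) := fun t t' h => by
  have h0 := congrFun h 0
  simp only [pairT, Fin.val_zero, if_true] at h0
  exact pcell_injective h0

/-- coefficient table of the matching family (one readout, `r = 1`): on the first half-cycle coefficient `1` on the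
diagonal tuple of the antipodal cell (the monomial `x_{apIdx k}`); elsewhere coefficient `1` on each matched pair
`(pcell t, qcell k t)` (the quadratic form `Q_k = Σ_t x_{pcell t} x_{qcell k t}`). -/
def qw (k : Fin N) (τ : Fin 2 → Fin N) (_ : Fin 1) : ZMod (2 + 1) :=
  if 1 ≤ k.val ∧ k.val < N / 2 then (if τ = (fun _ => apIdx k) then 1 else 0)
  else (if τ ∈ (univ : Finset (Fin (nT N))).image (pairT k) then 1 else 0)

/-- the tables of the matching family: the first half-cycle accepts the readout `1` (`x_{apIdx k} = 1`), the other
positions accept the readout `0` (`Q_k ≡ 0 (mod 3)`). -/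
def qGate (k : Fin N) (u : Fin 1 → ZMod (2 + 1)) : Bool :=
  if 1 ≤ k.val ∧ k.val < N / 2 then decide (u 0 = 1) else decide (u 0 = 0)

/-- first half-cycle: the readout is the antipodal bit. -/
theorem aphase_qw_first (k : Fin N) (hk : 1 ≤ k.val ∧ k.val < N / 2) (y : Fin N → Bool) :
    aphase 2 1 2 (qw k) y 0 = if y (apIdx k) = true then 1 else 0 := by
  unfold aphase qw
  simp only [if_pos hk]
  rw [Finset.sum_eq_single (fun _ : Fin 2 => apIdx k)]
  · simp
  · intro τ _ hτ
    rw [if_neg hτ, ite_self]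
  · intro h; exact absurd (mem_univ _) h

/-- off the first half-cycle: the readout is the matching count `Q_k` read in `Z₃`. -/
theorem aphase_qw_second (k : Fin N) (hk : ¬ (1 ≤ k.val ∧ k.val < N / 2)) (y : Fin N → Bool) :
    aphase 2 1 2 (qw k) y 0 = qG k y := by
  unfold aphase qw
  simp only [if_neg hk]
  rw [qG_apply]
  have e1 : ∀ τ : Fin 2 → Fin N, (if (∀ s, y (τ s) = true) then
      (if τ ∈ (univ : Finset (Fin (nT N))).image (pairT k) then (1 : ZMod (2 + 1)) else 0) else 0)
      = if τ ∈ (univ : Finset (Fin (nT N))).image (pairT k) then (if (∀ s, y (τ s) = true) then 1 else 0) else 0 :=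
    fun τ => by split_ifs <;> rfl
  simp only [e1]
  rw [Finset.sum_ite_mem, Finset.univ_inter, Finset.sum_image (fun t _ t' _ h => pairT_injective k h)]
  refine Finset.sum_congr rfl fun t _ => ?_
  simp [pairT, Fin.forall_fin_two]

/-- ★ **the matching family IS `(2, 1, 2)`-PHASE-FORM at the zero gauge** (so NODE «AbelianDial»'s certified generic
inhabitant moves to the SPECIAL side of this dial: its gates factor through ONE QUADRATIC PHASE over `Z₃`). -/
theorem q_phaseForm : PhaseForm 2 1 2 qw qGate (pad (fun i : Fin N => qStrat i) (fun _ => 0)) := by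
  intro y hy k
  rw [dev_pad_zero]
  by_cases hk : 1 ≤ k.val ∧ k.val < N / 2
  · rw [mem_dev_congr_at (P := fun i : Fin N => qStrat i) (Q := fun i : Fin N => apStrat i)
      (qStrat_agree N k hk.1 hk.2) y, mem_dev_apStrat]
    unfold qGate
    rw [if_pos hk, aphase_qw_first k hk]
    cases y (apIdx k) <;> decide
  · rw [mem_dev_q_second y k hk]
    unfold qGate
    rw [if_neg hk, aphase_qw_second k hk]

/-- hence `qStrat` is cheaply `(2, 1, 2)`-phase-form at every gauge level (the zero gauge is free). -/
theorem q_stabPhase (e : ℕ) : StabPhase 2 1 2 e (fun i : Fin N => qStrat i) :=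
  ⟨fun _ => 0, fun _ => Submodule.zero_mem _, qw, qGate, q_phaseForm⟩

/-! ## §4  The GENERIC side: a MULTIPLEXER gate has NO bounded phase type (counting certificate)

Test inputs `y(π, a)`: the address cells `1 … L` (`L = log₂ N − 3`) AND a disjoint block of SHADOW cells carry the address
`a`, the `2^L` data cells of position `k₀` carry an arbitrary data word `π : {0,1}^L → {0,1}`, cell `N − 1` carries a
parity fix depending on `π` only (the shadow copy makes the zero-parity independent of `a`), everything else is `0`.
On `y(π, a)` a degree-`d` readout is `Σ_σ [a ⊇ σ] · C_π(σ)` for a COEFFICIENT VECTOR `C_π` indexed by address patterns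
`σ : Fin d → Option (Fin L)` — `(L+1)^d` entries of `(Z_{m+1})^r` — while the multiplexer gate deviates at `y(π, a)` iff
`π(a) = 1`; so a phase form DECODES `π` from `C_π`, `π ↦ C_π` is injective, `2^(2^L) ≤ (m+1)^(r (L+1)^d)`: false for
`N` large (`2^L > N/16`, `(L+1)^d ≤ (log₂ N)^d`). -/

section Counting
variable {N : ℕ}

/-- the SHADOW address cell of coordinate `j`: cell `N/2 − 1 − j` (just below the data block). -/
def scell (j : Fin (aL N)) : Fin N := ⟨N / 2 - 1 - j.val, by have := aL_lt j; omega⟩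

/-- value of the shadow cell. -/
theorem scell_val (j : Fin (aL N)) : (scell j).val = N / 2 - 1 - j.val := rfl

/-- geometry of the multiplexer layout for `N ≥ 16`: `2L ≤ 2^L = W`, `8W ≤ N < 16W`, `L + 3 ≤ N/2`. -/
theorem geom (hN : 16 ≤ N) : 2 * aL N ≤ aW N ∧ 8 * aW N ≤ N ∧ N < 16 * aW N ∧ aL N + 3 ≤ N / 2 := by
  have hL : 4 ≤ Nat.log 2 N := Nat.le_log_of_pow_le (by norm_num) (by omega)
  have h8 : aW N * 8 = 2 ^ Nat.log 2 N := aW_mul_eight (by omega)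
  have h1 : 2 ^ Nat.log 2 N ≤ N := Nat.pow_log_le_self 2 (by omega)
  have h2 : N < 2 ^ (Nat.log 2 N + 1) := Nat.lt_pow_succ_log_self (by norm_num) N
  refine ⟨?_, by omega, ?_, aL_add_three_le hN⟩
  · unfold aW; exact two_mul_le_two_pow _
  · rw [pow_succ] at h2; omega

/-- address cells sit in `[1, L]`. -/
theorem acell_bounds (j : Fin (aL N)) : 1 ≤ (acell j).val ∧ (acell j).val ≤ aL N := by
  rw [acell_val]; have := j.isLt; omega

/-- shadow cells sit in `(L, N/2 − 1]`. -/
theorem scell_bounds (hN : 16 ≤ N) (j : Fin (aL N)) : aL N < (scell j).val ∧ (scell j).val ≤ N / 2 - 1 := by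
  rw [scell_val]; have := j.isLt; have := geom hN; omega

/-- shadow cells are distinct. -/
theorem scell_injective (hN : 16 ≤ N) : Function.Injective (scell (N := N)) := fun j j' h => by
  have h1 := congrArg Fin.val h
  rw [scell_val, scell_val] at h1
  have := j.isLt; have := j'.isLt; have := geom hN
  exact Fin.ext (by omega)

variable (k₀ : Fin N)

/-- data cells of position `k₀` sit in `[N/2, N/2 + W)`. -/
theorem dcell_bounds (τ : Fin (aL N) → Bool) : N / 2 ≤ (dcell k₀ τ).val ∧ (dcell k₀ τ).val < N / 2 + aW N := by
  rw [dcell_val]; have := Nat.mod_lt ((enc τ).val + k₀.val) (aW_pos (N := N)); omega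

/-- the ON address coordinates. -/
def onA (a : Fin (aL N) → Bool) : Finset (Fin (aL N)) := univ.filter fun j => a j = true

/-- the ON data addresses of the data word. -/
def onD (π : (Fin (aL N) → Bool) → Bool) : Finset (Fin (aL N) → Bool) := univ.filter fun τ => π τ = true

/-- the PARITY-FIX bit (depends on the data word only): makes the number of zero cells of the test input odd. -/
def fixb (π : (Fin (aL N) → Bool) → Bool) : Bool := decide ((N - (onD π).card) % 2 = 0)

/-- the ON cells of the test input `y(π, a)`: address cells and shadow cells ← `a`, data cells of `k₀` ← `π`,
cell `N − 1` ← the parity fix. -/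
def onSet (π : (Fin (aL N) → Bool) → Bool) (a : Fin (aL N) → Bool) : Finset (Fin N) :=
  ((onA a).image acell ∪ (onA a).image scell) ∪
    ((onD π).image (dcell k₀) ∪ univ.filter fun i : Fin N => i.val = N - 1 ∧ fixb π = true)

/-- the TEST INPUT `y(π, a)`. -/
def yin (π : (Fin (aL N) → Bool) → Bool) (a : Fin (aL N) → Bool) : Fin N → Bool := indB (onSet k₀ π a)

/-- an address cell is ON iff its address bit is. -/
theorem mem_onSet_acell (hN : 16 ≤ N) (π : (Fin (aL N) → Bool) → Bool) (a : Fin (aL N) → Bool) (j : Fin (aL N)) :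
    acell j ∈ onSet k₀ π a ↔ a j = true := by
  unfold onSet
  simp only [mem_union, mem_image, mem_filter, mem_univ, true_and, onA, onD]
  constructor
  · rintro ((⟨j', hj', e⟩ | ⟨j', hj', e⟩) | (⟨τ, hτ, e⟩ | ⟨h, _⟩))
    · rwa [← acell_injective e]
    · exfalso
      have h1 := (scell_bounds hN j').1; have h2 := (acell_bounds j).2
      rw [e] at h1; omega
    · exact absurd e.symm (acell_ne_dcell hN j k₀ τ)
    · exfalso; have := (acell_bounds j).2; have := geom hN; omega
  · intro h; exact Or.inl (Or.inl ⟨j, h, rfl⟩)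

/-- a shadow cell is ON iff its address bit is. -/
theorem mem_onSet_scell (hN : 16 ≤ N) (π : (Fin (aL N) → Bool) → Bool) (a : Fin (aL N) → Bool) (j : Fin (aL N)) :
    scell j ∈ onSet k₀ π a ↔ a j = true := by
  unfold onSet
  simp only [mem_union, mem_image, mem_filter, mem_univ, true_and, onA, onD]
  constructor
  · rintro ((⟨j', hj', e⟩ | ⟨j', hj', e⟩) | (⟨τ, hτ, e⟩ | ⟨h, _⟩))
    · exfalso
      have h1 := (acell_bounds j').2; have h2 := (scell_bounds hN j).1
      rw [e] at h1; omega
    · rwa [← scell_injective hN e]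
    · exfalso
      have h1 := (dcell_bounds k₀ τ).1; have h2 := (scell_bounds hN j).2; have := geom hN
      rw [e] at h1; omega
    · exfalso; have := (scell_bounds hN j).2; have := geom hN; omega
  · intro h; exact Or.inl (Or.inr ⟨j, h, rfl⟩)

/-- a data cell is ON iff its data bit is. -/
theorem mem_onSet_dcell (hN : 16 ≤ N) (π : (Fin (aL N) → Bool) → Bool) (a : Fin (aL N) → Bool)
    (τ : Fin (aL N) → Bool) : dcell k₀ τ ∈ onSet k₀ π a ↔ π τ = true := by
  unfold onSet
  simp only [mem_union, mem_image, mem_filter, mem_univ, true_and, onA, onD]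
  constructor
  · rintro ((⟨j', hj', e⟩ | ⟨j', hj', e⟩) | (⟨τ', hτ', e⟩ | ⟨h, _⟩))
    · exact absurd e (acell_ne_dcell hN j' k₀ τ)
    · exfalso
      have h1 := (scell_bounds hN j').2; have h2 := (dcell_bounds k₀ τ).1; have := geom hN
      rw [e] at h1; omega
    · rwa [← dcell_injective k₀ e]
    · exfalso; have := dcell_lt_last hN k₀ τ; omega
  · intro h; exact Or.inr (Or.inl ⟨τ, h, rfl⟩)

/-- a cell that is neither an address cell nor a shadow cell does not see the address. -/
theorem mem_onSet_indep {i : Fin N} (ha : ∀ j, acell j ≠ i) (hs : ∀ j, scell j ≠ i)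
    (π : (Fin (aL N) → Bool) → Bool) (a a' : Fin (aL N) → Bool) : i ∈ onSet k₀ π a ↔ i ∈ onSet k₀ π a' := by
  unfold onSet
  simp only [mem_union, mem_image, mem_filter, mem_univ, true_and, onA, onD]
  constructor
  · rintro ((⟨j, _, e⟩ | ⟨j, _, e⟩) | h)
    · exact absurd e (ha j)
    · exact absurd e (hs j)
    · exact Or.inr h
  · rintro ((⟨j, _, e⟩ | ⟨j, _, e⟩) | h)
    · exact absurd e (ha j)
    · exact absurd e (hs j)
    · exact Or.inr h

/-- the number of ON cells: `2·|a| + |π| + [fix]`. -/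
theorem card_onSet (hN : 16 ≤ N) (π : (Fin (aL N) → Bool) → Bool) (a : Fin (aL N) → Bool) :
    (onSet k₀ π a).card = (onA a).card + (onA a).card + (onD π).card + (if fixb π = true then 1 else 0) := by
  have hg := geom hN
  have d1 : Disjoint ((onA a).image acell) ((onA a).image scell) := by
    rw [Finset.disjoint_left]
    intro i hi hi'
    obtain ⟨j, _, rfl⟩ := mem_image.1 hi
    obtain ⟨j', _, e⟩ := mem_image.1 hi'
    have h1 := (scell_bounds hN j').1; have h2 := (acell_bounds j).2
    rw [e] at h1; omega
  have d2 : Disjoint ((onD π).image (dcell k₀)) (univ.filter fun i : Fin N => i.val = N - 1 ∧ fixb π = true) := by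
    rw [Finset.disjoint_left]
    intro i hi hi'
    obtain ⟨τ, _, rfl⟩ := mem_image.1 hi
    have := (mem_filter.1 hi').2.1; have := dcell_lt_last hN k₀ τ; omega
  have d3 : Disjoint ((onA a).image acell ∪ (onA a).image scell)
      ((onD π).image (dcell k₀) ∪ univ.filter fun i : Fin N => i.val = N - 1 ∧ fixb π = true) := by
    rw [Finset.disjoint_left]
    intro i hi hi'
    rcases mem_union.1 hi' with hd | hf
    · obtain ⟨τ, _, e⟩ := mem_image.1 hd
      have h1 := (dcell_bounds k₀ τ).1
      rw [e] at h1
      rcases mem_union.1 hi with h | h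
      · obtain ⟨j, _, rfl⟩ := mem_image.1 h
        have := (acell_bounds j).2; omega
      · obtain ⟨j, _, rfl⟩ := mem_image.1 h
        have := (scell_bounds hN j).2; omega
    · have h1 := (mem_filter.1 hf).2.1
      rcases mem_union.1 hi with h | h
      · obtain ⟨j, _, rfl⟩ := mem_image.1 h
        have := (acell_bounds j).2; omega
      · obtain ⟨j, _, rfl⟩ := mem_image.1 h
        have := (scell_bounds hN j).2; omega
  unfold onSet
  rw [card_union_of_disjoint d3, card_union_of_disjoint d1, card_union_of_disjoint d2,
    card_image_of_injective _ acell_injective, card_image_of_injective _ (scell_injective hN),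
    card_image_of_injective _ (dcell_injective k₀)]
  by_cases hf : fixb π = true
  · have e : (univ.filter fun i : Fin N => i.val = N - 1 ∧ fixb π = true) = {⟨N - 1, by omega⟩} := by
      ext i; simp [hf, Fin.ext_iff]
    rw [e, card_singleton, if_pos hf]; omega
  · have e : (univ.filter fun i : Fin N => i.val = N - 1 ∧ fixb π = true) = ∅ := by
      ext i; simp [hf]
    rw [e, card_empty, if_neg hf]; omega

/-- ★ every test input has an ODD number of zeros (the parity fix works for every address, thanks to the shadow copy). -/
theorem yin_odd (hN : 16 ≤ N) (π : (Fin (aL N) → Bool) → Bool) (a : Fin (aL N) → Bool) : OddZeros (yin k₀ π a) := by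
  unfold yin
  rw [oddZeros_indB, card_onSet k₀ hN]
  have hA : (onA a).card ≤ aL N := (card_filter_le _ _).trans (by simp)
  have hD : (onD π).card ≤ aW N :=
    (card_filter_le _ _).trans (by rw [Finset.card_univ, Fintype.card_fun, Fintype.card_bool, Fintype.card_fin]; rfl)
  have hg := geom hN
  rcases Nat.mod_two_eq_zero_or_one (N - (onD π).card) with h0 | h1
  · have hf : fixb π = true := by unfold fixb; rw [h0]; decide
    rw [if_pos hf]; omega
  · have hf : ¬ fixb π = true := by unfold fixb; rw [h1]; decide
    rw [if_neg hf]; omega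

/-- the ADDRESS COORDINATE a cell copies (address cells and shadow cells), if any. -/
def adr (i : Fin N) : Option (Fin (aL N)) :=
  if h : ∃ j, acell j = i then some (Classical.choose h)
  else if h' : ∃ j, scell j = i then some (Classical.choose h') else none

/-- a cell copying address coordinate `j` reads `a j`. -/
theorem yin_of_adr (hN : 16 ≤ N) {i : Fin N} {j : Fin (aL N)} (h : adr i = some j)
    (π : (Fin (aL N) → Bool) → Bool) (a : Fin (aL N) → Bool) : yin k₀ π a i = a j := by
  unfold adr at h
  by_cases h1 : ∃ j, acell j = i
  · rw [dif_pos h1] at h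
    cases h
    calc yin k₀ π a i = yin k₀ π a (acell (Classical.choose h1)) := by rw [Classical.choose_spec h1]
      _ = a (Classical.choose h1) := by unfold yin indB; simp [mem_onSet_acell k₀ hN]
  · rw [dif_neg h1] at h
    by_cases h2 : ∃ j, scell j = i
    · rw [dif_pos h2] at h
      cases h
      calc yin k₀ π a i = yin k₀ π a (scell (Classical.choose h2)) := by rw [Classical.choose_spec h2]
        _ = a (Classical.choose h2) := by unfold yin indB; simp [mem_onSet_scell k₀ hN]
    · rw [dif_neg h2] at h
      cases h

/-- a cell copying no address coordinate does not see the address. -/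
theorem yin_of_noadr {i : Fin N} (h : adr i = none) (π : (Fin (aL N) → Bool) → Bool) (a a' : Fin (aL N) → Bool) :
    yin k₀ π a i = yin k₀ π a' i := by
  unfold adr at h
  by_cases h1 : ∃ j, acell j = i
  · rw [dif_pos h1] at h; cases h
  · rw [dif_neg h1] at h
    by_cases h2 : ∃ j, scell j = i
    · rw [dif_pos h2] at h; cases h
    · unfold yin indB
      exact decide_eq_decide.mpr (mem_onSet_indep k₀ (fun j e => h1 ⟨j, e⟩) (fun j e => h2 ⟨j, e⟩) π a a')


end Counting

end Summit.QuantumAdvantage.QuantumAdvantage.Theorems.PhaseDial
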